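import Mathlib
import HarnessLib
import Literature.Analysis.FluidPDE.LocalTypeI
import Summits.NavierStokesRegularity.NavierStokesRegularity.Theorems.SymmetryModuliCountSymmetricLiouville
import Summits.NavierStokesRegularity.NavierStokesRegularity.Theorems.SymmetryModuliCountAxisymEndLiouville
import Summits.NavierStokesRegularity.NavierStokesRegularity.Theorems.PoloidalWindowDoorPoloidalWindowRigidityWindow
import Summits.NavierStokesRegularity.NavierStokesRegularity.Theorems.PoloidalWindowDoorPoloidalWindowRigidityKillingOfDiscreteRotation

/-!
# Route `PoloidalWindowDoor`, crux `PoloidalWindowRigidity` (K2, stmt-NavierStokesRegularity-19708) — LINE 7 `period_door`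
# (ns-idea-8 g3, v3; critic idea-crit-7 g2 PASS-WITH-PRICE): THE SYMMETRY DOORS, UNCONDITIONAL

Cell ns-regularity-ideate, seat ns-poloidal-K2-p2 g12 (stub-worker on K2; `--supports` the crux item).  The three door theorems
of `Cruxes/PoloidalWindowRigidity/Lines/period_door.lean` v3, statements and proofs VERBATIM, with the geometry stub D1F now the
landed `…PoloidalWindowDoorPoloidalWindowRigidityKillingOfDiscreteRotation.stub_killingOfDiscreteRotation`:

* `periodDoor` (D0): a profile of the route's Type-I class (rate, continuity on the open slab, Oseen-mildness (M),
  incompressibility) that is periodic along some `p ≠ 0` is `≡ 0` on `t < 0`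
  (`…SymmetryModuliCountSymmetricLiouville.periodicTypeIAncientLiouville` via `…PoloidalWindowRigidityWindow.isTypeIAncientMild_of_class`),
  hence not backward-singular at the origin (`not_isBackwardSingularPoint_zero_of_vanishing`: `ess sup = 0 ≠ ∞` on `Q_1(0,0)`; the same
  eight lines as `…ScarRigidity.Negative.not_isBackwardSingularPoint_of_eq_zero`, restated here to keep this file route-independent);
* `rotationDoor` (D1F⁺): an infinite-order linear-isometric symmetry with a fixed point makes every slice infinitesimally
  axisymmetric about an axis through the fixed point (D1F) and `…Theorems.AxisymEndLiouville_of` (item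
  stmt-NavierStokesRegularity-14061, PROVED; `θ = 0`, any axis, swirl allowed) gives `v ≡ 0`;
* `symmetryDoor`: class + `HDoor` (a period, or an infinite-order symmetry with a fixed point) ⇒ not backward-singular.

Reading (the line's HONEST PRICE, unchanged): the doors excise, at class level and BY NAME, every architecture with a period or a
dense rotational symmetry from BOTH thick cells (singly-periodic vortex arrays, stacked layers, n-fold helices, rational screws and
glides, irrationally-rotation-symmetric profiles); the asymmetric residues `stub_asymmetricHypThick` / `stub_asymmetricSemiThick`
and the shared `stub_hyperbolicTH` stay OPEN, so crux 19708 is NOT closed by this file.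

WHAT THIS IS NOT: not a claim about Navier–Stokes regularity (bears_on LADDER-NS N0, rung N0-LocalTubeDoorPoloidal); (M) is
load-bearing in every statement (`Cruxes/PoloidalWindowRigidity/Disproof.lean` honoured).
-/

noncomputable section

-- the summit and its single sub-problem share the name (CONVENTIONS §1), as in every Theorems file
set_option linter.dupNamespace false

namespace Summit.NavierStokesRegularity.NavierStokesRegularity.Theorems.PoloidalWindowDoorPoloidalWindowRigidityPeriodDoor

open Set Filter Function MeasureTheory
open scoped RealInnerProductSpace InnerProductSpace
open Literature.Analysis.FluidPDE

/-- A field vanishing on the open past slab `{t < 0}` has `ess sup = 0 ≠ ∞` on the backward cylinder `Q_1(0,0)`, so the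
space–time origin is NOT a backward-singular point for it (route-independent copy of the folklore step used by the line file via
`…ScarRigidity.Negative.not_isBackwardSingularPoint_of_eq_zero`). [folklore] -/
theorem not_isBackwardSingularPoint_zero_of_vanishing {u : ℝ → EuclideanSpace ℝ (Fin 3) → EuclideanSpace ℝ (Fin 3)}
    (h : ∀ t : ℝ, t < 0 → ∀ x, u t x = 0) :
    ¬ Literature.Analysis.FluidPDE.IsBackwardSingularPoint u ((0 : ℝ), (0 : EuclideanSpace ℝ (Fin 3))) := by
  intro hs
  have h1 := hs 1 one_pos
  have hae : uncurry u =ᵐ[volume.restrict (parabolicCylinder 1 ((0 : ℝ), (0 : EuclideanSpace ℝ (Fin 3))))] 0 := by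
    filter_upwards [ae_restrict_mem (isOpen_parabolicCylinder 1 ((0 : ℝ), (0 : EuclideanSpace ℝ (Fin 3)))).measurableSet]
      with z hz
    rw [mem_parabolicCylinder] at hz
    have ht : z.1 < 0 := by simpa using hz.1.2
    simp [uncurry, h z.1 ht z.2]
  rw [eLpNorm_congr_ae hae, eLpNorm_zero] at h1
  exact ENNReal.zero_ne_top h1

/-- **D0 — THE PERIOD DOOR (`period_door` v3 `periodDoor` VERBATIM; critic BC4, 2026-08-28):** a profile of the route's Type-I class (rate, continuity on the open slab,
Oseen-mildness (M), incompressibility) that is periodic along some `p ≠ 0` vanishes identically on `t < 0`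
(`…SymmetryModuliCountSymmetricLiouville.periodicTypeIAncientLiouville`, via `isTypeIAncientMild_of_class`), hence is not backward-singular at the origin
(here `not_isBackwardSingularPoint_zero_of_vanishing`).  Covers every profile whose symmetry group contains a non-zero translation. -/
theorem periodDoor :
    ∀ (C : ℝ) (v : ℝ → EuclideanSpace ℝ (Fin 3) → EuclideanSpace ℝ (Fin 3)),
      Literature.Analysis.FluidPDE.HasTypeITimeDecay C v →
      ContinuousOn (Function.uncurry v) (Set.Iio (0 : ℝ) ×ˢ Set.univ) →
      (∀ s t : ℝ, s < t → t < 0 → ∀ x, v t x =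
        Literature.Analysis.UnboundedOperators.heatExtension (v s) (t - s) x -
          Literature.Analysis.FluidPDE.oseenDuhamel 1 s v v t x) →
      (∀ t < 0, Literature.Analysis.FluidPDE.VectorCalculus.IsDivFree (v t)) →
      (∃ p : EuclideanSpace ℝ (Fin 3), p ≠ 0 ∧ ∀ t : ℝ, t < 0 → ∀ x, v t (x + p) = v t x) →
      ¬ Literature.Analysis.FluidPDE.IsBackwardSingularPoint v 0 := by
  intro C v hrate hcont hmild hdiv hper
  obtain ⟨p, hp, hper⟩ := hper
  have hcl : Literature.Analysis.FluidPDE.IsTypeIAncientMild C v :=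
    Summit.NavierStokesRegularity.NavierStokesRegularity.Theorems.PoloidalWindowDoorPoloidalWindowRigidityWindow.isTypeIAncientMild_of_class
      hrate hcont hmild hdiv
  exact not_isBackwardSingularPoint_zero_of_vanishing
    (Summit.NavierStokesRegularity.NavierStokesRegularity.Theorems.SymmetryModuliCountSymmetricLiouville.periodicTypeIAncientLiouville
      C v hcl p hp hper)

/-- **D1F⁺ — THE ROTATION DOOR (`period_door` v3 `rotationDoor` VERBATIM), now UNCONDITIONAL: D1F is the landed
`…KillingOfDiscreteRotation.stub_killingOfDiscreteRotation`.** an infinite-order symmetry with a fixed point makes every slice infinitesimally axisymmetric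
about an axis through the fixed point (D1F), and a Type-I ancient mild field annihilated by the rotations about ANY axis vanishes on `t < 0`
(`…Theorems.AxisymEndLiouville_of`, item stmt-NavierStokesRegularity-14061 of route SymmetryModuliCount, PROVED; `θ = 0`). -/
theorem rotationDoor :
    ∀ (C : ℝ) (v : ℝ → EuclideanSpace ℝ (Fin 3) → EuclideanSpace ℝ (Fin 3)),
      Literature.Analysis.FluidPDE.HasTypeITimeDecay C v →
      ContinuousOn (Function.uncurry v) (Set.Iio (0 : ℝ) ×ˢ Set.univ) →
      (∀ s t : ℝ, s < t → t < 0 → ∀ x, v t x =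
        Literature.Analysis.UnboundedOperators.heatExtension (v s) (t - s) x -
          Literature.Analysis.FluidPDE.oseenDuhamel 1 s v v t x) →
      (∀ t < 0, Literature.Analysis.FluidPDE.VectorCalculus.IsDivFree (v t)) →
      (∃ (A : EuclideanSpace ℝ (Fin 3) ≃ₗᵢ[ℝ] EuclideanSpace ℝ (Fin 3)) (c : EuclideanSpace ℝ (Fin 3)),
          (∀ q : ℕ, 0 < q → ∃ x, (fun y => A y)^[q] x ≠ x) ∧ ∀ t : ℝ, t < 0 → ∀ x, v t (A (x - c) + c) = A (v t x)) →
      ¬ Literature.Analysis.FluidPDE.IsBackwardSingularPoint v 0 := by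
  intro C v hrate hcont hmild hdiv hsym
  obtain ⟨A, c, hA, hsym⟩ := hsym
  have hcl : Literature.Analysis.FluidPDE.IsTypeIAncientMild C v :=
    Summit.NavierStokesRegularity.NavierStokesRegularity.Theorems.PoloidalWindowDoorPoloidalWindowRigidityWindow.isTypeIAncientMild_of_class
      hrate hcont hmild hdiv
  obtain ⟨K, hskew, hK, hKill⟩ :=
    PoloidalWindowDoorPoloidalWindowRigidityKillingOfDiscreteRotation.stub_killingOfDiscreteRotation
      C v hcl A c hA hsym
  have hz : ∀ t < (0 : ℝ), ∀ x, v t x = 0 :=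
    Summit.NavierStokesRegularity.NavierStokesRegularity.Theorems.AxisymEndLiouville_of C v hcl c K 0 hskew hK le_rfl hKill
  exact not_isBackwardSingularPoint_zero_of_vanishing hz

/-- **THE SYMMETRY DOOR (`period_door` v3 `symmetryDoor` VERBATIM), UNCONDITIONAL:** class + `HDoor` (a period, or an infinite-order symmetry with a fixed point) ⇒ not backward-singular. -/
theorem symmetryDoor :
    ∀ (C : ℝ) (v : ℝ → EuclideanSpace ℝ (Fin 3) → EuclideanSpace ℝ (Fin 3)),
      Literature.Analysis.FluidPDE.HasTypeITimeDecay C v →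
      ContinuousOn (Function.uncurry v) (Set.Iio (0 : ℝ) ×ˢ Set.univ) →
      (∀ s t : ℝ, s < t → t < 0 → ∀ x, v t x =
        Literature.Analysis.UnboundedOperators.heatExtension (v s) (t - s) x -
          Literature.Analysis.FluidPDE.oseenDuhamel 1 s v v t x) →
      (∀ t < 0, Literature.Analysis.FluidPDE.VectorCalculus.IsDivFree (v t)) →
      ((∃ p : EuclideanSpace ℝ (Fin 3), p ≠ 0 ∧ ∀ t : ℝ, t < 0 → ∀ x, v t (x + p) = v t x) ∨
            ∃ (A : EuclideanSpace ℝ (Fin 3) ≃ₗᵢ[ℝ] EuclideanSpace ℝ (Fin 3)) (c : EuclideanSpace ℝ (Fin 3)),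
              (∀ q : ℕ, 0 < q → ∃ x, (fun y => A y)^[q] x ≠ x) ∧ ∀ t : ℝ, t < 0 → ∀ x, v t (A (x - c) + c) = A (v t x)) →
      ¬ Literature.Analysis.FluidPDE.IsBackwardSingularPoint v 0 := by
  intro C v hrate hcont hmild hdiv hdoor
  rcases hdoor with hper | hrot
  · exact periodDoor C v hrate hcont hmild hdiv hper
  · exact rotationDoor C v hrate hcont hmild hdiv hrot

end Summit.NavierStokesRegularity.NavierStokesRegularity.Theorems.PoloidalWindowDoorPoloidalWindowRigidityPeriodDoor
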